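import Mathlib
import Summits.Ventures.HodgeRepro2.T5AdicCompletionConjugation
import Summits.Ventures.HodgeRepro2.T5AdicCompletionGaloisInvariance
import Summits.Ventures.HodgeRepro2.T5AdicCompletionResidueField
import Summits.Ventures.HodgeRepro2.T5AdicCompletionIntegralBasis
import Summits.Ventures.HodgeRepro2.T5UnramifiedCharacter
import Summits.Ventures.HodgeRepro2.T5UnramifiedNormResidue

/-!
# `N(O_{E_v}^×) = O_{F_v}^×` at an inert place, on Mathlib's completions

THE UNRAMIFIED HALF OF THE LOCAL NORM INDEX THEOREM (local class field theory for the unramified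
quadratic extension; Serre, *Local Fields*, Ch. V §2, Prop. 3 — the statement behind
route/T5-route-2.md's «η_v = the norm character» and its unramifiedness at inert places): on
Mathlib's completions `Kv := v.adicCompletion K ⊆ Lw := w.adicCompletion L` of number fields with
`[Lw : Kv] = 2` and an INERT uniformiser `ϖ` (irreducible in `O_Kv`, still irreducible in `O_Lw`),
for the non-trivial `σ ∈ Gal(Lw/Kv)`, EVERY unit `u` of `O_Kv` is a norm `x · σ x` of a unit `x`
of `O_Lw` (`exists_val_eq_one_mul_algEquiv_eq`, `exists_units_mul_algEquiv_eq`).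

Proof: `T5UnramifiedNormResidue` (residue-level norm and trace surjectivity from Mathlib's finite
field theory, fed into the successive approximation of `T5UnramifiedNormApprox`) gives units `x_n`
with `x_n · σ x_n ≡ u (mod ϖ^n)` for every `n`; the sets
`C_n = {x ∈ Lw | v x = 1 ∧ v (x σ x − u) ≤ v ϖ ^ n}` are closed, decreasing, non-empty subsets of
the compact `O_Lw`, so their intersection is non-empty (Cantor), and a point of it satisfies
`x σ x = u` exactly (`v (x σ x − u) ≤ exp (−n)` for all `n`).

Consequences for the norm group of `Lwˣ` in `Kvˣ` (the index `[Kvˣ : N Lwˣ] = 2` and the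
identification of the quadratic character trivial on norms with the unramified quadratic
character) are left to a follow-up file.

Declaration per README §8(d): «uses an L-value-free non-vanishing device: NO».
-/

namespace Summit.Ventures.HodgeRepro2.T5AdicCompletionNormSurjective

open IsDedekindDomain HeightOneSpectrum WithZero T5UnramifiedNormApprox

section ValuedTopology

variable {R : Type*} [Ring R] {Γ₀ : Type*} [LinearOrderedCommGroupWithZero Γ₀] [Valued R Γ₀]

/-- `{x | v x ≤ v x₀}` is closed in a valued ring (a closed ball of the valuation topology). -/
theorem isClosed_setOf_val_le_val (x₀ : R) : IsClosed {x : R | Valued.v x ≤ Valued.v x₀} := by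
  have : {x : R | Valued.v x ≤ Valued.v x₀} =
      {x : R | Valued.v.restrict x ≤ Valued.v.restrict x₀} := by
    ext x
    simp only [Set.mem_setOf_eq]
    rw [← not_lt, ← not_lt, Valuation.restrict_lt_iff]
  rw [this]
  exact Valued.isClosed_closedBall R _

/-- `{x | 1 ≤ v x}` is closed (the complement of the open unit ball). -/
theorem isClosed_setOf_one_le_val : IsClosed {x : R | 1 ≤ Valued.v x} := by
  have : {x : R | 1 ≤ Valued.v x} = {x : R | Valued.v.restrict x < 1}ᶜ := by
    ext x
    simp only [Set.mem_setOf_eq, Set.mem_compl_iff, Valuation.restrict_lt_one_iff, not_lt]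
  rw [this]
  exact (Valued.isOpen_ball R 1).isClosed_compl

/-- `{x | v x = 1}` is closed. -/
theorem isClosed_setOf_val_eq_one : IsClosed {x : R | Valued.v x = 1} := by
  have : {x : R | Valued.v x = 1} =
      {x : R | Valued.v x ≤ Valued.v (1 : R)} ∩ {x : R | 1 ≤ Valued.v x} := by
    ext x
    simp only [Set.mem_setOf_eq, Set.mem_inter_iff, map_one]
    exact le_antisymm_iff
  rw [this]
  exact (isClosed_setOf_val_le_val (1 : R)).inter isClosed_setOf_one_le_val

end ValuedTopology

variable {K : Type*} [Field K] [NumberField K] (v : HeightOneSpectrum (NumberField.RingOfIntegers K))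
  {L : Type*} [Field L] [NumberField L] [Algebra K L]
  (w : HeightOneSpectrum (NumberField.RingOfIntegers L)) [w.asIdeal.LiesOver v.asIdeal]

/-- The residue field of `O_Kv` has at least two elements. -/
theorem two_le_card_residueField :
    2 ≤ Nat.card (IsLocalRing.ResidueField (adicCompletionIntegers K v)) :=
  Finite.one_lt_card_iff_nontrivial.mpr inferInstance

/-- A unit of `O_Lw` has valuation `1` in `Lw`. -/
theorem val_coe_units_eq_one (x : (adicCompletionIntegers L w)ˣ) :
    Valued.v ((x : adicCompletionIntegers L w) : adicCompletion L w) = 1 := by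
  have hle : Valued.v ((x : adicCompletionIntegers L w) : adicCompletion L w) ≤ 1 :=
    (mem_adicCompletionIntegers _ _ _).mp (x : adicCompletionIntegers L w).2
  have hnot : ¬ Valued.v ((x : adicCompletionIntegers L w) : adicCompletion L w) < 1 := by
    rw [← T5AdicCompletionResidueField.mem_maximalIdeal_iff, IsLocalRing.mem_maximalIdeal,
      mem_nonunits_iff, not_not]
    exact x.isUnit
  exact le_antisymm hle (not_lt.mp hnot)

/-- Divisibility by `ϖ^n` in `O_Lw` bounds the valuation in `Lw`. -/
theorem val_le_pow_of_dvd {ϖ y : adicCompletionIntegers L w} {n : ℕ} (h : ϖ ^ n ∣ y) :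
    Valued.v (y : adicCompletion L w) ≤ Valued.v (ϖ : adicCompletion L w) ^ n := by
  obtain ⟨t, rfl⟩ := h
  rw [Subring.coe_mul, map_mul]
  simp only [SubmonoidClass.coe_pow, map_pow]
  calc Valued.v (ϖ : adicCompletion L w) ^ n * Valued.v (t : adicCompletion L w)
      ≤ Valued.v (ϖ : adicCompletion L w) ^ n * 1 :=
        mul_le_mul' le_rfl ((mem_adicCompletionIntegers _ _ _).mp t.2)
    _ = _ := mul_one _

variable (h2 : Module.finrank (adicCompletion K v) (adicCompletion L w) = 2)
  {ϖ : adicCompletionIntegers K v} (hϖ : Irreducible ϖ)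
  (hϖS : Irreducible (algebraMap (adicCompletionIntegers K v) (adicCompletionIntegers L w) ϖ))
  (σ : Gal(adicCompletion L w/adicCompletion K v)) (hσ : σ ≠ 1)

include h2 hϖ hϖS hσ in
/-- THE APPROXIMATION on the completions: every unit of `O_Kv` is a norm modulo every power of the
inert uniformiser (the residue-level inputs are supplied by `T5AdicCompletionIntegralBasis`'s
residue-field count and `T5AdicCompletionConjugation`'s involution). -/
theorem exists_units_normConj_sub_dvd (u : adicCompletionIntegers K v) (hu : IsUnit u) :
    ∀ n : ℕ, 1 ≤ n → ∃ x : (adicCompletionIntegers L w)ˣ,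
      (algebraMap (adicCompletionIntegers K v) (adicCompletionIntegers L w) ϖ) ^ n ∣
        normConj (T5AdicCompletionConjugation.restrictIntegers v w σ) (x : adicCompletionIntegers L w) -
          algebraMap (adicCompletionIntegers K v) (adicCompletionIntegers L w) u := by
  have hR := T5AdicCompletionResidueField.card_residueField v
  have hS := T5AdicCompletionIntegralBasis.card_residueField_of_quadratic_inert v w h2 hϖ hϖS
  rw [hR] at hS
  exact T5UnramifiedNormResidue.exists_units_normConj_sub_dvd
    (T5AdicCompletionConjugation.restrictIntegers v w σ)
    (T5AdicCompletionConjugation.restrictIntegers_algebraMap v w σ)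
    (T5AdicCompletionConjugation.restrictIntegers_restrictIntegers v w h2 σ hσ)
    (fun z hz => T5AdicCompletionConjugation.exists_algebraMap_eq_of_restrictIntegers_eq v w h2 σ hσ hz)
    (hR ▸ two_le_card_residueField v) hR hS hϖS u hu

/-- The closed sets of the Cantor argument:
`C n = {x ∈ Lw | v x = 1 ∧ v (x σ x − u) ≤ v ϖ ^ (n + 1)}`. -/
def cantorSet (u : adicCompletionIntegers K v) (n : ℕ) : Set (adicCompletion L w) :=
  {x | Valued.v x = 1 ∧
    Valued.v (x * σ x - algebraMap (adicCompletion K v) (adicCompletion L w) (u : adicCompletion K v)) ≤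
      Valued.v (((algebraMap (adicCompletionIntegers K v) (adicCompletionIntegers L w) ϖ :
        adicCompletionIntegers L w) : adicCompletion L w)) ^ (n + 1)}

include hϖS in
/-- `v (alg ϖ) = exp (−1)` in `Lw` (the inert uniformiser stays a uniformiser). -/
theorem val_algebraMap_uniformizer :
    Valued.v (((algebraMap (adicCompletionIntegers K v) (adicCompletionIntegers L w) ϖ :
      adicCompletionIntegers L w) : adicCompletion L w)) = exp (-1) :=
  T5UnramifiedCharacter.val_algebraMap_eq_exp_neg_one v w hϖS

include hϖS in
/-- The Cantor sets are decreasing. -/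
theorem cantorSet_succ_subset (u : adicCompletionIntegers K v) (n : ℕ) :
    cantorSet v w (ϖ := ϖ) σ u (n + 1) ⊆ cantorSet v w (ϖ := ϖ) σ u n := by
  intro x hx
  refine ⟨hx.1, le_trans hx.2 ?_⟩
  rw [val_algebraMap_uniformizer v w hϖS, ← exp_nsmul, ← exp_nsmul, exp_le_exp]
  simp only [smul_neg, nsmul_eq_mul, mul_one]
  omega

/-- The Cantor sets are closed. -/
theorem isClosed_cantorSet (u : adicCompletionIntegers K v) (n : ℕ) :
    IsClosed (cantorSet v w (ϖ := ϖ) σ u n) := by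
  have hcont : Continuous fun x : adicCompletion L w =>
      x * σ x - algebraMap (adicCompletion K v) (adicCompletion L w) (u : adicCompletion K v) :=
    (continuous_id.mul (T5AdicCompletionGaloisInvariance.continuous_algEquiv v w σ)).sub
      continuous_const
  have : cantorSet v w (ϖ := ϖ) σ u n = {x | Valued.v x = 1} ∩
      ((fun x : adicCompletion L w =>
        x * σ x - algebraMap (adicCompletion K v) (adicCompletion L w) (u : adicCompletion K v)) ⁻¹'
        {y | Valued.v y ≤ Valued.v ((((algebraMap (adicCompletionIntegers K v)
          (adicCompletionIntegers L w) ϖ : adicCompletionIntegers L w) : adicCompletion L w)) ^ (n + 1))}) := by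
    ext x
    simp only [cantorSet, Set.mem_setOf_eq, Set.mem_inter_iff, Set.mem_preimage, map_pow]
  rw [this]
  exact isClosed_setOf_val_eq_one.inter ((isClosed_setOf_val_le_val _).preimage hcont)

/-- The Cantor sets lie in the compact `O_Lw`, hence are compact. -/
theorem isCompact_cantorSet (u : adicCompletionIntegers K v) (n : ℕ) :
    IsCompact (cantorSet v w (ϖ := ϖ) σ u n) := by
  refine (T5AdicCompletionGaloisInvariance.isCompact_adicCompletionIntegers w).of_isClosed_subset
    (isClosed_cantorSet v w σ u n) ?_
  intro x hx
  exact (mem_adicCompletionIntegers _ _ _).mpr hx.1.le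

include h2 hϖ hϖS hσ in
/-- The Cantor sets are non-empty (from the approximation). -/
theorem cantorSet_nonempty (u : adicCompletionIntegers K v) (hu : IsUnit u) (n : ℕ) :
    (cantorSet v w (ϖ := ϖ) σ u n).Nonempty := by
  obtain ⟨x, hx⟩ := exists_units_normConj_sub_dvd v w h2 hϖ hϖS σ hσ u hu (n + 1) (by omega)
  refine ⟨((x : adicCompletionIntegers L w) : adicCompletion L w), val_coe_units_eq_one w x, ?_⟩
  have h := val_le_pow_of_dvd w hx
  have e : ((normConj (T5AdicCompletionConjugation.restrictIntegers v w σ) (x : adicCompletionIntegers L w) -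
      algebraMap (adicCompletionIntegers K v) (adicCompletionIntegers L w) u : adicCompletionIntegers L w) :
        adicCompletion L w) =
      ((x : adicCompletionIntegers L w) : adicCompletion L w) *
        σ ((x : adicCompletionIntegers L w) : adicCompletion L w) -
        algebraMap (adicCompletion K v) (adicCompletion L w) (u : adicCompletion K v) := by
    rw [normConj_apply]
    push_cast
    rw [T5AdicCompletionConjugation.coe_restrictIntegers]
    rfl
  rwa [e] at h

/-- A point of all the Cantor sets is an exact norm: `v (x σ x − u) ≤ exp (−(n+1))` for every `n`
forces `x σ x − u = 0`. -/
theorem eq_of_forall_val_le_exp_neg {y : adicCompletion L w}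
    (h : ∀ n : ℕ, Valued.v y ≤ exp (-(n + 1 : ℤ))) : y = 0 := by
  by_contra hy
  have hne : Valued.v y ≠ 0 := (Valuation.ne_zero_iff _).mpr hy
  obtain ⟨k, hk⟩ : ∃ k : ℤ, Valued.v y = exp k := ⟨(Valued.v y).log, (exp_log hne).symm⟩
  have := h (k.natAbs + 1)
  rw [hk, exp_le_exp] at this
  omega

include h2 hϖ hϖS hσ in
/-- `N(O_{E_v}^×) = O_{F_v}^×` AT AN INERT PLACE: every unit `u` of `O_Kv` is `x · σ x` for an
`x ∈ Lw` with `v x = 1` (i.e. a unit of `O_Lw`). -/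
theorem exists_val_eq_one_mul_algEquiv_eq (u : adicCompletionIntegers K v) (hu : IsUnit u) :
    ∃ x : adicCompletion L w, Valued.v x = 1 ∧
      x * σ x = algebraMap (adicCompletion K v) (adicCompletion L w) (u : adicCompletion K v) := by
  obtain ⟨x, hx⟩ := IsCompact.nonempty_iInter_of_sequence_nonempty_isCompact_isClosed
    (cantorSet v w (ϖ := ϖ) σ u) (cantorSet_succ_subset v w hϖS σ u)
    (cantorSet_nonempty v w h2 hϖ hϖS σ hσ u hu) (isCompact_cantorSet v w σ u 0)
    (isClosed_cantorSet v w σ u)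
  rw [Set.mem_iInter] at hx
  refine ⟨x, (hx 0).1, ?_⟩
  rw [← sub_eq_zero]
  apply eq_of_forall_val_le_exp_neg w
  intro n
  have := (hx n).2
  rwa [val_algebraMap_uniformizer v w hϖS, ← exp_nsmul, smul_neg, nsmul_eq_mul, mul_one,
    Nat.cast_add, Nat.cast_one] at this

include h2 hϖ hϖS hσ in
/-- The unit form: every unit of `O_Kv` is the norm `x · σ x` of a unit `x` of `O_Lw`. -/
theorem exists_units_mul_algEquiv_eq (u : (adicCompletionIntegers K v)ˣ) :
    ∃ x : (adicCompletionIntegers L w)ˣ,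
      ((x : adicCompletionIntegers L w) : adicCompletion L w) *
        σ ((x : adicCompletionIntegers L w) : adicCompletion L w) =
        algebraMap (adicCompletion K v) (adicCompletion L w) ((u : adicCompletionIntegers K v) : adicCompletion K v) := by
  obtain ⟨x, hx1, hx⟩ := exists_val_eq_one_mul_algEquiv_eq v w h2 hϖ hϖS σ hσ u u.isUnit
  have hxmem : x ∈ adicCompletionIntegers L w := (mem_adicCompletionIntegers _ _ _).mpr hx1.le
  have hxu : IsUnit (⟨x, hxmem⟩ : adicCompletionIntegers L w) := by
    rw [← IsLocalRing.notMem_maximalIdeal, T5AdicCompletionResidueField.mem_maximalIdeal_iff]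
    simp [hx1]
  exact ⟨hxu.unit, by simpa using hx⟩

end Summit.Ventures.HodgeRepro2.T5AdicCompletionNormSurjective
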